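import Summits.QuantumFields.YangMills.Theorems.ConvexGribovBodyPoincareToGapTemporalDecay
import Summits.QuantumFields.YangMills.Theorems.ConvexGribovBodyPoincareToGapCrossCov
import Summits.QuantumFields.YangMills.Theorems.ConvexGribovBodyPoincareToGapTimeReflect
import Summits.QuantumFields.YangMills.Theorems.ConvexGribovBodyPoincareToGapPlaquette
import Literature.MathematicalPhysics.QuantumLattice.ContinuumLimitLGT

/-!
# Pairs and the plaquette species: what the slice Poincaré hypothesis gives for the crux's own correlator
(crux `ConvexGribovBody.PoincareToGap`, stmt-QuantumFields-8781, line `Sketch`, lead c2, §3b–§3c of `Lines/Sketch.lean`)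

Continuation of `…PoincareToGapTemporalDecay` (`Cov_S(A, τ_n A) ≤ κ·dir(A)/(n+1)` for admissible `(2,3)`-layer
observables, from the crux hypothesis alone).  Two consequences, both compositions of LANDED stubs of the line:

* `crossTemporalDecay_of_slicePoincare` (pairs): for two admissible layer observables `A, B`,
  `Cov_S(A, τ_n B)² ≤ 2 κ² dir(A) dir(B)/(n+1)²` for `1 ≤ n ≤ S` — reflection positivity in Cauchy–Schwarz form
  (`stub_crossCov_sq_le`, G1, symmetrised), time-reversal invariance of Wilson's measure
  (`stub_wilsonMeasure_timeReflect_invariant`, G2) making the cross-covariance even in `n`, and the balanced split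
  `s + t = n + 1` against the two autocovariance bounds of `temporalDecay_of_slicePoincare`;
* `plaquetteCorr_le_of_sliceHypothesis` (the plaquette species `O = plaquetteObservable r.ρ _ 2 3` of the crux's
  conclusion): under the crux hypothesis AS TYPED (`∀ S ≥ S₀`), `0 ≤ β`, `0 ≤ κ`:
  `0 ≤ latticeConnectedCorr r.ρ β (2S+1) O.F O.F n ≤ 4 κ N/(n+1)` for all `S ≥ max S₀ 1`, `n ≤ S` — i.e. the crux's
  conclusion for this pair with `C e^{−mn}` replaced by `4κN/(n+1)` (`stub_plaquette_admissible`, G3: the torus reading of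
  `O` is gauge-invariant, reads the `(2,3)`-layer, is `√N`-Lipschitz and has Dirichlet form `≤ 4N`).

The exponential rate remains exactly the open cores PB1 ∧ PB2 of the line.  References: Osterwalder–Seiler, Ann. Phys.
110 (1978) §2; `Cruxes/PoincareToGap/Lines/Sketch.lean`. [folklore]
-/

noncomputable section

open scoped BigOperators Topology
open MeasureTheory Filter
open Literature.MathematicalPhysics.QuantumFieldTheory Literature.MathematicalPhysics.QuantumLattice

namespace Summit.QuantumFields.YangMills.Theorems.PoincareToGap

/-- **Pairs: `Cov_S(A, τ_n B)² ≤ 2 κ² dir(A) dir(B)/(n+1)²` for `1 ≤ n ≤ S`.**  On one torus (`S ≥ 1`, `β ≥ 0`,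
`κ ≥ 0`, slice Poincaré at `S`), for two bounded measurable gauge-invariant link-Lipschitz observables `A, B` of
the `(2,3)`-layer `Λ₀`, the temporal cross-covariance at separation `n` (`B` translated by `n` units of Euclidean
time, `T⁰_{−n}`) is bounded through reflection positivity in Cauchy–Schwarz form (G1, symmetrised; the time
reversal G2 makes the cross-covariance even in `n`; balanced split
`s = ⌈(n+1)/2⌉`, `t = n + 1 − s`) by the two autocovariances `c_A(2s−1) ≤ κ dir A/(n+1)` and
`c_B(2t−1) ≤ 2κ dir B/(n+1)` of §3 (evenness and `c(S+1) = c(S)` handle the boundary case `n = S` odd). -/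
theorem crossTemporalDecay_of_slicePoincare :
    ∀ (G : Type) [Group G] [TopologicalSpace G] [IsTopologicalGroup G] [CompactSpace G]
      [MeasurableSpace G] [BorelSpace G] (r : LatticeRep G) (β : ℝ), 0 ≤ β → ∀ κ : ℝ, 0 ≤ κ → ∀ S : ℕ, 1 ≤ S →
    (∀ f : GaugeConfig 4 (2 * S + 1) G → ℝ, IsGaugeInvariant f →
      (∀ U V : GaugeConfig 4 (2 * S + 1) G,
        (∀ e : Edge 4 (2 * S + 1), e.1 0 = 0 → e.2 ≠ 0 → U e = V e) → f U = f V) →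
      (∃ K : ℝ, ∀ U V : GaugeConfig 4 (2 * S + 1) G,
        |f U - f V| ≤ K * ∑ e, Real.sqrt (∑ a, ∑ b, ‖(r.ρ (U e) - r.ρ (V e)) a b‖ ^ 2)) →
      ∫ U, (f U - ∫ V, f V ∂(wilsonMeasure r.ρ β : Measure (GaugeConfig 4 (2 * S + 1) G))) ^ 2
          ∂(wilsonMeasure r.ρ β : Measure (GaugeConfig 4 (2 * S + 1) G)) ≤
        κ * ∑ e : Edge 4 (2 * S + 1), (if e.1 0 = 0 ∧ e.2 ≠ 0 then
          ∫ U, (Filter.limsup (fun g : G => |f (Function.update U e g) - f U| /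
              Real.sqrt (∑ a, ∑ b, ‖(r.ρ g - r.ρ (U e)) a b‖ ^ 2)) (𝓝[≠] (U e))) ^ 2
            ∂(wilsonMeasure r.ρ β : Measure (GaugeConfig 4 (2 * S + 1) G)) else 0)) →
    ∀ μ : Measure (GaugeConfig 4 (2 * S + 1) G),
      μ = (wilsonMeasure r.ρ β : Measure (GaugeConfig 4 (2 * S + 1) G)) →
    ∀ A B : GaugeConfig 4 (2 * S + 1) G → ℝ, Measurable A → Measurable B →
      (∃ M : ℝ, ∀ U, |A U| ≤ M) → (∃ M : ℝ, ∀ U, |B U| ≤ M) →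
      IsGaugeInvariant A → IsGaugeInvariant B →
      DependsOn A {e : Edge 4 (2 * S + 1) | e.1 0 = 0 ∧ e.1 1 = 0 ∧ e.2 ≠ 0 ∧ e.2 ≠ 1} →
      DependsOn B {e : Edge 4 (2 * S + 1) | e.1 0 = 0 ∧ e.1 1 = 0 ∧ e.2 ≠ 0 ∧ e.2 ≠ 1} →
      (∃ K : ℝ, ∀ U V : GaugeConfig 4 (2 * S + 1) G,
        |A U - A V| ≤ K * ∑ e, Real.sqrt (∑ a, ∑ b, ‖(r.ρ (U e) - r.ρ (V e)) a b‖ ^ 2)) →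
      (∃ K : ℝ, ∀ U V : GaugeConfig 4 (2 * S + 1) G,
        |B U - B V| ≤ K * ∑ e, Real.sqrt (∑ a, ∑ b, ‖(r.ρ (U e) - r.ρ (V e)) a b‖ ^ 2)) →
    ∀ n : ℕ, 1 ≤ n → n ≤ S →
      (∫ U, A U * B (torusConfigShift (Pi.single (0 : Fin 4) (-(n : ZMod (2 * S + 1))) :
            Site 4 (2 * S + 1)) U) ∂μ - (∫ U, A U ∂μ) * ∫ U, B U ∂μ) ^ 2 ≤
        2 * κ ^ 2 *
          (∑ e : Edge 4 (2 * S + 1), (if e.1 0 = 0 ∧ e.2 ≠ 0 then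
            ∫ U, (Filter.limsup (fun g : G => |A (Function.update U e g) - A U| /
                Real.sqrt (∑ a, ∑ b, ‖(r.ρ g - r.ρ (U e)) a b‖ ^ 2)) (𝓝[≠] (U e))) ^ 2 ∂μ else 0)) *
          (∑ e : Edge 4 (2 * S + 1), (if e.1 0 = 0 ∧ e.2 ≠ 0 then
            ∫ U, (Filter.limsup (fun g : G => |B (Function.update U e g) - B U| /
                Real.sqrt (∑ a, ∑ b, ‖(r.ρ g - r.ρ (U e)) a b‖ ^ 2)) (𝓝[≠] (U e))) ^ 2 ∂μ else 0)) /
          ((n : ℝ) + 1) ^ 2 := by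
  intro G _ _ _ _ _ _ r β hβ κ hκ S hS hP μ hμ A B hAm hBm hAb hBb hAg hBg hAd hBd hAl hBl n hn1 hnS
  -- notation for the two autocovariance functions and the two Dirichlet forms
  set cA : ZMod (2 * S + 1) → ℝ := fun m =>
    ∫ U, A U * A (torusConfigShift (Pi.single (0 : Fin 4) m : Site 4 (2 * S + 1)) U) ∂μ -
      (∫ U, A U ∂μ) * ∫ U, A U ∂μ with hcA
  set cB : ZMod (2 * S + 1) → ℝ := fun m =>
    ∫ U, B U * B (torusConfigShift (Pi.single (0 : Fin 4) m : Site 4 (2 * S + 1)) U) ∂μ -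
      (∫ U, B U ∂μ) * ∫ U, B U ∂μ with hcB
  set dA : ℝ := ∑ e : Edge 4 (2 * S + 1), (if e.1 0 = 0 ∧ e.2 ≠ 0 then
      ∫ U, (Filter.limsup (fun g : G => |A (Function.update U e g) - A U| /
          Real.sqrt (∑ a, ∑ b, ‖(r.ρ g - r.ρ (U e)) a b‖ ^ 2)) (𝓝[≠] (U e))) ^ 2 ∂μ else 0) with hdA
  set dB : ℝ := ∑ e : Edge 4 (2 * S + 1), (if e.1 0 = 0 ∧ e.2 ≠ 0 then
      ∫ U, (Filter.limsup (fun g : G => |B (Function.update U e g) - B U| /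
          Real.sqrt (∑ a, ∑ b, ‖(r.ρ g - r.ρ (U e)) a b‖ ^ 2)) (𝓝[≠] (U e))) ^ 2 ∂μ else 0) with hdB
  -- F4 for `A` and `B`: non-negativity and evenness
  obtain ⟨hAnn, hAev, -⟩ := stub_cov_nonneg_logConvex G r β hβ S hS μ hμ A hAm hAb
    (hAd.mono fun e he => ⟨he.1, he.2.2.1⟩)
  obtain ⟨hBnn, hBev, -⟩ := stub_cov_nonneg_logConvex G r β hβ S hS μ hμ B hBm hBb
    (hBd.mono fun e he => ⟨he.1, he.2.2.1⟩)
  have hAev' : ∀ m, cA (-m) = cA m := fun m => by simp only [hcA, hAev m]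
  have hBev' : ∀ m, cB (-m) = cB m := fun m => by simp only [hcB, hBev m]
  -- §3 for `A` and `B`
  have hdecA : ∀ m : ℕ, m ≤ S → cA (m : ZMod (2 * S + 1)) ≤ κ * dA / ((m : ℝ) + 1) := fun m hm =>
    temporalDecay_of_slicePoincare G r β hβ κ hκ S hS hP μ hμ A hAm hAb hAg hAd hAl m hm
  have hdecB : ∀ m : ℕ, m ≤ S → cB (m : ZMod (2 * S + 1)) ≤ κ * dB / ((m : ℝ) + 1) := fun m hm =>
    temporalDecay_of_slicePoincare G r β hβ κ hκ S hS hP μ hμ B hBm hBb hBg hBd hBl m hm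
  have hdA0 : 0 ≤ dA := Finset.sum_nonneg fun e _ => by
    split_ifs
    · exact integral_nonneg fun U => sq_nonneg _
    · exact le_rfl
  have hdB0 : 0 ≤ dB := Finset.sum_nonneg fun e _ => by
    split_ifs
    · exact integral_nonneg fun U => sq_nonneg _
    · exact le_rfl
  -- the balanced split `s + t = n + 1`
  obtain ⟨s, t, hs1, ht1, hst, h2s, h2s', h2t, h2t'⟩ : ∃ s t : ℕ, 1 ≤ s ∧ 1 ≤ t ∧ s + t = n + 1 ∧
      n + 1 ≤ 2 * s ∧ 2 * s ≤ n + 2 ∧ n ≤ 2 * t ∧ 2 * t ≤ n + 1 :=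
    ⟨(n + 2) / 2, n + 1 - (n + 2) / 2, by omega, by omega, by omega, by omega, by omega, by omega, by omega⟩
  have hL : n + 1 ≤ 2 * S + 1 := by omega
  have hsval : ((s : ℕ) : ZMod (2 * S + 1)).val = s := ZMod.val_cast_of_lt (by omega)
  have htval : ((t : ℕ) : ZMod (2 * S + 1)).val = t := ZMod.val_cast_of_lt (by omega)
  -- G1
  have hG := stub_crossCov_sq_le G r β hβ S hS μ hμ A B hAm hBm hAb hBb
    (hAd.mono fun e he => ⟨he.1, he.2.2.1⟩) (hBd.mono fun e he => ⟨he.1, he.2.2.1⟩)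
    (s : ZMod (2 * S + 1)) (t : ZMod (2 * S + 1)) (by omega) (by omega) (by omega) (by omega)
  have hsum : ((s : ℕ) : ZMod (2 * S + 1)) + ((t : ℕ) : ZMod (2 * S + 1)) = (n : ZMod (2 * S + 1)) + 1 := by
    rw [← Nat.cast_add, hst]; push_cast; ring
  have hidx : (1 : ZMod (2 * S + 1)) - (s : ZMod (2 * S + 1)) - (t : ZMod (2 * S + 1)) =
      -((n : ℕ) : ZMod (2 * S + 1)) := by
    linear_combination (-1 : ZMod (2 * S + 1)) * hsum
  have hidx' : (s : ZMod (2 * S + 1)) + (t : ZMod (2 * S + 1)) - 1 = ((n : ℕ) : ZMod (2 * S + 1)) := by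
    linear_combination hsum
  rw [hidx, hidx'] at hG
  -- G2: time reversal makes the cross-covariance even in the separation
  have hXev : ∀ dd : ZMod (2 * S + 1),
      ∫ U, A U * B (torusConfigShift (Pi.single (0 : Fin 4) dd : Site 4 (2 * S + 1)) U) ∂μ =
        ∫ U, A U * B (torusConfigShift (Pi.single (0 : Fin 4) (-dd) : Site 4 (2 * S + 1)) U) ∂μ := by
    intro dd
    obtain ⟨-, hΘ⟩ := stub_wilsonMeasure_timeReflect_invariant G r β 4 (2 * S + 1)
    have hAd' : DependsOn A {e : Edge 4 (2 * S + 1) | e.1 0 = 0 ∧ e.2 ≠ 0} :=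
      hAd.mono fun e he => ⟨he.1, he.2.2.1⟩
    have hBd' : DependsOn B {e : Edge 4 (2 * S + 1) | e.1 0 = 0 ∧ e.2 ≠ 0} :=
      hBd.mono fun e he => ⟨he.1, he.2.2.1⟩
    have hA1 : ∀ V : GaugeConfig 4 (2 * S + 1) G, A V.timeReflect =
        A (torusConfigShift (Pi.single (0 : Fin 4) (-1) : Site 4 (2 * S + 1)) V) := fun V => by
      have h := Summit.QuantumFields.YangMills.Theorems.PoincareToGap.covLC_layer_timeReflect hAd' 0 V
      simpa [Summit.QuantumFields.YangMills.Theorems.PoincareToGap.covLC_shift_zero] using h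
    have hB1 : ∀ V : GaugeConfig 4 (2 * S + 1) G,
        B (torusConfigShift (Pi.single (0 : Fin 4) dd : Site 4 (2 * S + 1)) V.timeReflect) =
        B (torusConfigShift (Pi.single (0 : Fin 4) (-(1 + dd)) : Site 4 (2 * S + 1)) V) := fun V => by
      have h := Summit.QuantumFields.YangMills.Theorems.PoincareToGap.covLC_layer_timeReflect hBd' (-dd) V
      simp only [neg_neg] at h
      rw [h]; congr 2; ring
    calc ∫ U, A U * B (torusConfigShift (Pi.single (0 : Fin 4) dd : Site 4 (2 * S + 1)) U) ∂μ
        = ∫ U, A U.timeReflect *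
            B (torusConfigShift (Pi.single (0 : Fin 4) dd : Site 4 (2 * S + 1)) U.timeReflect) ∂μ := by
          rw [hμ]
          exact (hΘ fun U => A U *
            B (torusConfigShift (Pi.single (0 : Fin 4) dd : Site 4 (2 * S + 1)) U)).symm
      _ = ∫ U, A (torusConfigShift (Pi.single (0 : Fin 4) (-1) : Site 4 (2 * S + 1)) U) *
            B (torusConfigShift (Pi.single (0 : Fin 4) (-(1 + dd)) : Site 4 (2 * S + 1)) U) ∂μ := by
          simp only [hA1, hB1]
      _ = ∫ U, A U * B (torusConfigShift (Pi.single (0 : Fin 4) (-dd) : Site 4 (2 * S + 1)) U) ∂μ := by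
          rw [Summit.QuantumFields.YangMills.Theorems.PoincareToGap.covLC_integral_comp_shift_mul_comp_shift
            r.ρ β hμ]
          congr 1; funext U; congr 2
          rw [← Pi.single_sub]; congr 1; ring
  rw [hXev ((n : ℕ) : ZMod (2 * S + 1))] at hG
  -- so the symmetrised square is `(2 X)²`
  have hG' : (∫ U, A U * B (torusConfigShift (Pi.single (0 : Fin 4) (-(n : ZMod (2 * S + 1))) :
      Site 4 (2 * S + 1)) U) ∂μ - (∫ U, A U ∂μ) * ∫ U, B U ∂μ) ^ 2 ≤
      cA (1 - 2 * (s : ZMod (2 * S + 1))) * cB (1 - 2 * (t : ZMod (2 * S + 1))) := by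
    have h4 := hG
    simp only [hcA, hcB]
    nlinarith [h4]
  -- the two autocovariances on the right of G1
  have hpos : (0 : ℝ) < (n : ℝ) + 1 := by positivity
  have hκdA : 0 ≤ κ * dA := mul_nonneg hκ hdA0
  have hκdB : 0 ≤ κ * dB := mul_nonneg hκ hdB0
  have hcA_le : cA (1 - 2 * (s : ZMod (2 * S + 1))) ≤ κ * dA / ((n : ℝ) + 1) := by
    have e1 : (1 : ZMod (2 * S + 1)) - 2 * ((s : ℕ) : ZMod (2 * S + 1)) =
        -(((2 * s - 1 : ℕ) : ZMod (2 * S + 1))) := by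
      rw [Nat.cast_sub (by omega)]; push_cast; ring
    rw [e1, hAev']
    rcases Nat.lt_or_ge (2 * s - 1) (S + 1) with hlt | hge
    · refine (hdecA (2 * s - 1) (by omega)).trans ?_
      have e2 : (((2 * s - 1 : ℕ) : ℝ) + 1) = 2 * (s : ℝ) := by
        rw [Nat.cast_sub (by omega)]; push_cast; ring
      rw [e2]
      exact div_le_div_of_nonneg_left hκdA hpos (by exact_mod_cast h2s)
    · -- boundary case: `2s - 1 = S + 1`, `n = S`, and `c(S+1) = c(-S) = c(S)`
      have hS1 : 2 * s - 1 = S + 1 := by omega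
      have hnS' : n = S := by omega
      have e3 : (((2 * s - 1 : ℕ)) : ZMod (2 * S + 1)) = -((S : ℕ) : ZMod (2 * S + 1)) := by
        rw [hS1, eq_neg_iff_add_eq_zero, ← Nat.cast_add, show S + 1 + S = 2 * S + 1 by omega,
          ZMod.natCast_self]
      rw [e3, hAev', hnS']
      exact hdecA S le_rfl
  have hcB_le : cB (1 - 2 * (t : ZMod (2 * S + 1))) ≤ 2 * (κ * dB) / ((n : ℝ) + 1) := by
    have e1 : (1 : ZMod (2 * S + 1)) - 2 * ((t : ℕ) : ZMod (2 * S + 1)) =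
        -(((2 * t - 1 : ℕ) : ZMod (2 * S + 1))) := by
      rw [Nat.cast_sub (by omega)]; push_cast; ring
    rw [e1, hBev']
    refine (hdecB (2 * t - 1) (by omega)).trans ?_
    have e2 : (((2 * t - 1 : ℕ) : ℝ) + 1) = 2 * (t : ℝ) := by
      rw [Nat.cast_sub (by omega)]; push_cast; ring
    rw [e2, div_le_div_iff₀ (by positivity) hpos]
    have h4t : (n : ℝ) + 1 ≤ 2 * (2 * (t : ℝ)) := by
      have h : (n + 1 : ℕ) ≤ 4 * t := by omega
      have h' : ((n + 1 : ℕ) : ℝ) ≤ ((4 * t : ℕ) : ℝ) := by exact_mod_cast h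
      push_cast at h'
      linarith
    nlinarith [hκdB, h4t]
  -- assemble
  have hprod : cA (1 - 2 * (s : ZMod (2 * S + 1))) * cB (1 - 2 * (t : ZMod (2 * S + 1))) ≤
      (κ * dA / ((n : ℝ) + 1)) * (2 * (κ * dB) / ((n : ℝ) + 1)) :=
    mul_le_mul hcA_le hcB_le (hBnn _) (div_nonneg hκdA hpos.le)
  have hfin : (∫ U, A U * B (torusConfigShift (Pi.single (0 : Fin 4) (-(n : ZMod (2 * S + 1))) :
      Site 4 (2 * S + 1)) U) ∂μ - (∫ U, A U ∂μ) * ∫ U, B U ∂μ) ^ 2 ≤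
      (κ * dA / ((n : ℝ) + 1)) * (2 * (κ * dB) / ((n : ℝ) + 1)) := hG'.trans hprod
  have heq : (κ * dA / ((n : ℝ) + 1)) * (2 * (κ * dB) / ((n : ℝ) + 1)) =
      2 * κ ^ 2 * dA * dB / ((n : ℝ) + 1) ^ 2 := by
    field_simp
  rw [heq] at hfin
  simpa only [hdA, hdB] using hfin

/-- **The crux's conclusion for the `(2,3)`-plaquette pair, with `C e^{−mn}` replaced by `4κN/(n+1)`, is a
THEOREM of the hypothesis.**  Let `O := plaquetteObservable r.ρ _ 2 3` (a `YMSpecies G`).  If `0 ≤ β`, `0 ≤ κ` and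
the antecedent of `ConvexGribovBody.PoincareToGap` holds from `S₀` on, then for all `S ≥ max S₀ 1` and `n ≤ S`:
`0 ≤ latticeConnectedCorr r.ρ β (2S+1) O.F O.F n ≤ 4 κ N / (n+1)` (the instance `SecondCountableTopology G`, needed
to NAME the species, always holds: `(r.continuous.isClosedEmbedding r.injective).isEmbedding.secondCountableTopology`).
Proof: the torus correlation is
`Cov_μ(P, P ∘ T⁰_{−n})` for the torus reading `P` of `O` (`toTorusObservable_comp_configShift`), even in `n` (F4);
`P` is an admissible `(2,3)`-layer observable with Dirichlet form `≤ 4N` (G3), so §3 applies. -/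
theorem plaquetteCorr_le_of_sliceHypothesis :
    ∀ (G : Type) [Group G] [TopologicalSpace G] [IsTopologicalGroup G] [CompactSpace G]
      [MeasurableSpace G] [BorelSpace G] [SecondCountableTopology G] (r : LatticeRep G) (β : ℝ),
      0 ≤ β → ∀ κ : ℝ, 0 ≤ κ → ∀ S₀ : ℕ,
    (∀ S : ℕ, S₀ ≤ S → ∀ f : GaugeConfig 4 (2 * S + 1) G → ℝ, IsGaugeInvariant f →
      (∀ U V : GaugeConfig 4 (2 * S + 1) G,
        (∀ e : Edge 4 (2 * S + 1), e.1 0 = 0 → e.2 ≠ 0 → U e = V e) → f U = f V) →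
      (∃ K : ℝ, ∀ U V : GaugeConfig 4 (2 * S + 1) G,
        |f U - f V| ≤ K * ∑ e, Real.sqrt (∑ a, ∑ b, ‖(r.ρ (U e) - r.ρ (V e)) a b‖ ^ 2)) →
      ∫ U, (f U - ∫ V, f V ∂(wilsonMeasure r.ρ β : Measure (GaugeConfig 4 (2 * S + 1) G))) ^ 2
          ∂(wilsonMeasure r.ρ β : Measure (GaugeConfig 4 (2 * S + 1) G)) ≤
        κ * ∑ e : Edge 4 (2 * S + 1), (if e.1 0 = 0 ∧ e.2 ≠ 0 then
          ∫ U, (Filter.limsup (fun g : G => |f (Function.update U e g) - f U| /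
              Real.sqrt (∑ a, ∑ b, ‖(r.ρ g - r.ρ (U e)) a b‖ ^ 2)) (𝓝[≠] (U e))) ^ 2
            ∂(wilsonMeasure r.ρ β : Measure (GaugeConfig 4 (2 * S + 1) G)) else 0)) →
    ∀ S n : ℕ, S₀ ≤ S → 1 ≤ S → n ≤ S →
      0 ≤ latticeConnectedCorr r.ρ β (2 * S + 1) (plaquetteObservable r.ρ r.continuous 2 3).F
          (plaquetteObservable r.ρ r.continuous 2 3).F n ∧
      latticeConnectedCorr r.ρ β (2 * S + 1) (plaquetteObservable r.ρ r.continuous 2 3).F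
          (plaquetteObservable r.ρ r.continuous 2 3).F n ≤ 4 * κ * r.N / ((n : ℝ) + 1) := by
  intro G _ _ _ _ _ _ _ r β hβ κ hκ S₀ hP S n hS₀ hS hn
  set μ : Measure (GaugeConfig 4 (2 * S + 1) G) := wilsonMeasure r.ρ β with hμ
  haveI := isProbabilityMeasure_wilsonMeasure (d := 4) (L := 2 * S + 1) r.ρ r.continuous β
  set P : GaugeConfig 4 (2 * S + 1) G → ℝ := fun U => plaquetteObs r.ρ 0 2 3 (torusLift (2 * S + 1) U)
    with hPdef
  obtain ⟨hPg, hPd, hPl, hPdir⟩ := stub_plaquette_admissible G r S hS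
  have hPl' : ∃ K : ℝ, ∀ U V : GaugeConfig 4 (2 * S + 1) G,
      |P U - P V| ≤ K * ∑ e, Real.sqrt (∑ a, ∑ b, ‖(r.ρ (U e) - r.ρ (V e)) a b‖ ^ 2) := ⟨_, hPl⟩
  have hPc : Continuous P :=
    Summit.QuantumFields.YangMills.Theorems.BrascampLiebVacuum.rpHankel_continuous r hPl'
  have hPm : Measurable P := hPc.measurable
  have hPb : ∃ M : ℝ, ∀ U, |P U| ≤ M :=
    Summit.QuantumFields.YangMills.Theorems.BrascampLiebVacuum.rpHankel_bounded hPc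
  -- the torus correlation is `Cov(P, P ∘ T⁰_{-n})`
  have hshift : ∀ U : GaugeConfig 4 (2 * S + 1) G,
      plaquetteObs r.ρ 0 2 3 (configShift (-Pi.single 0 ((n : ℕ) : ℤ)) (torusLift (2 * S + 1) U)) =
        P (torusConfigShift (Pi.single (0 : Fin 4) (-(n : ZMod (2 * S + 1))) : Site 4 (2 * S + 1)) U) := by
    intro U
    have h := congrFun (toTorusObservable_comp_configShift (G := G) (2 * S + 1)
      (-Pi.single 0 ((n : ℕ) : ℤ)) (plaquetteObs r.ρ 0 2 3)) U
    simp only [toTorusObservable_apply, Function.comp_apply] at h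
    have hproj : Literature.Probability.LatticeModels.Torus.proj (2 * S + 1)
        (-Pi.single 0 ((n : ℕ) : ℤ)) =
        (Pi.single (0 : Fin 4) (-(n : ZMod (2 * S + 1))) : Site 4 (2 * S + 1)) := by
      funext i
      by_cases hi : i = 0
      · subst hi; simp [Literature.Probability.LatticeModels.Torus.proj_apply]
      · simp [Literature.Probability.LatticeModels.Torus.proj_apply, hi]
    rw [h, hproj]
  have hcorr : latticeConnectedCorr r.ρ β (2 * S + 1) (plaquetteObservable r.ρ r.continuous 2 3).F
      (plaquetteObservable r.ρ r.continuous 2 3).F n =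
      ∫ U, P U * P (torusConfigShift (Pi.single (0 : Fin 4) (-(n : ZMod (2 * S + 1))) :
          Site 4 (2 * S + 1)) U) ∂μ - (∫ U, P U ∂μ) * ∫ U, P U ∂μ := by
    unfold latticeConnectedCorr
    simp only [plaquetteObservable_F, hshift]
    rfl
  obtain ⟨hnn, hev, -⟩ := stub_cov_nonneg_logConvex G r β hβ S hS μ hμ P hPm hPb
    (hPd.mono fun e he => ⟨he.1, he.2.2.1⟩)
  rw [hcorr, hev]
  refine ⟨hnn _, ?_⟩
  have hdec := temporalDecay_of_slicePoincare G r β hβ κ hκ S hS (hP S hS₀) μ hμ P hPm hPb hPg hPd hPl' n hn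
  refine hdec.trans ?_
  have hpos : (0 : ℝ) < (n : ℝ) + 1 := by positivity
  rw [div_le_div_iff_of_pos_right hpos]
  calc κ * (∑ e : Edge 4 (2 * S + 1), (if e.1 0 = 0 ∧ e.2 ≠ 0 then
          ∫ U, (Filter.limsup (fun g : G => |P (Function.update U e g) - P U| /
              Real.sqrt (∑ a, ∑ b, ‖(r.ρ g - r.ρ (U e)) a b‖ ^ 2)) (𝓝[≠] (U e))) ^ 2 ∂μ else 0))
      ≤ κ * (4 * r.N) := mul_le_mul_of_nonneg_left (hPdir μ inferInstance) hκ
    _ = 4 * κ * r.N := by ring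

end Summit.QuantumFields.YangMills.Theorems.PoincareToGap

end
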